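import Mathlib
import HarnessLib.Audit
import HarnessLib

/-!
# L3TimeExponentPincer — ring datum calculus X: the decay integral `∫ dx / max(a, |x|²)³ ≲ a^{-3/2}`

Support kernel for the crux `L3CascadeJaw` (item stmt-NavierStokesRegularity-19499): the
energy UPPER bound of the ring datum (`‖u₀(x)‖² ≤ (104/9)K²/max(a,|x|²)³`,
`norm_ringField_sq_le_max`) needs `∫⁻ ofReal (1/max(a,|x|²)³) ≤ C a^{-3/2}` with a constant `C`
independent of the core scale `a = ℓ²`.  No radial integral is computed: scaling `x = √a • y`
(`lintegral_comp_smul_three`) reduces to `a = 1`, where `1/max(1,|y|²)³ ≤ 64 (1+|y|)^{-6}` is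
integrable on `ℝ³` (`finite_integral_one_add_norm`, `3 < 6`); the constant is
`64 · I₆`, `I₆ := ∫⁻ (1+‖y‖)^{-6} dy < ∞` (`lintegral_inv_max_cube_le`).
WHAT THIS IS NOT: measure-theory bookkeeping only.
-/

namespace Summit.NavierStokesRegularity.NavierStokesRegularity.Theorems.L3TimeExponentPincerRingDatumDecayIntegral

open Real Set Metric MeasureTheory Module
open scoped ENNReal

/-- **Scaling of `∫⁻` on `ℝ³`**: `∫⁻ f(R • x) dx = |R³|⁻¹ ∫⁻ f` (`R ≠ 0`). -/
theorem lintegral_comp_smul_three (f : EuclideanSpace ℝ (Fin 3) → ℝ≥0∞) {R : ℝ} (hR : R ≠ 0) :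
    ∫⁻ x, f (R • x) = ENNReal.ofReal (|(R ^ 3)⁻¹|) * ∫⁻ x, f x := by
  set e := (Homeomorph.smul (isUnit_iff_ne_zero.2 hR).unit :
    EuclideanSpace ℝ (Fin 3) ≃ₜ EuclideanSpace ℝ (Fin 3)).toMeasurableEquiv
  have he : (e : EuclideanSpace ℝ (Fin 3) → EuclideanSpace ℝ (Fin 3)) = fun x => R • x := rfl
  have h1 : ∫⁻ x, f (R • x) = ∫⁻ x, f (e x) := by rw [he]
  rw [h1, ← lintegral_map_equiv f e, he, Measure.map_addHaar_smul volume hR, lintegral_smul_measure,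
    finrank_euclideanSpace_fin, smul_eq_mul]

/-- The finite constant `I₆ = ∫⁻ (1 + ‖y‖)^{-6} dy` on `ℝ³`. -/
theorem lintegral_one_add_norm_rpow_neg_six_lt_top :
    ∫⁻ y : EuclideanSpace ℝ (Fin 3), ENNReal.ofReal ((1 + ‖y‖) ^ (-(6 : ℝ))) < ∞ :=
  finite_integral_one_add_norm (by rw [finrank_euclideanSpace_fin]; norm_num)

/-- Pointwise: `1/max(1, t²)³ ≤ 64 (1+t)^{-6}` for `t ≥ 0`. -/
theorem inv_max_one_sq_cube_le {t : ℝ} (ht : 0 ≤ t) :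
    ((max 1 (t ^ 2)) ^ 3)⁻¹ ≤ 64 * (1 + t) ^ (-(6 : ℝ)) := by
  have hm : ((1 + t) / 2) ^ 2 ≤ max 1 (t ^ 2) := by
    rcases le_or_gt t 1 with h | h
    · calc ((1 + t) / 2) ^ 2 ≤ 1 ^ 2 := by gcongr; linarith
        _ = 1 := one_pow 2
        _ ≤ max 1 (t ^ 2) := le_max_left _ _
    · calc ((1 + t) / 2) ^ 2 ≤ t ^ 2 := by gcongr; linarith
        _ ≤ max 1 (t ^ 2) := le_max_right _ _
  have hpos : 0 < (1 + t) := by linarith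
  have h6 : (1 + t) ^ (-(6 : ℝ)) = ((1 + t) ^ 6)⁻¹ := by
    rw [Real.rpow_neg hpos.le, show (6 : ℝ) = ((6 : ℕ) : ℝ) by norm_num, Real.rpow_natCast]
  rw [h6]
  have hm3 : ((1 + t) / 2) ^ 6 ≤ (max 1 (t ^ 2)) ^ 3 := by
    rw [show ((1 + t) / 2) ^ 6 = (((1 + t) / 2) ^ 2) ^ 3 by ring]
    exact pow_le_pow_left₀ (sq_nonneg _) hm 3
  have hq : 0 < ((1 + t) / 2) ^ 6 := by positivity
  calc ((max 1 (t ^ 2)) ^ 3)⁻¹ ≤ (((1 + t) / 2) ^ 6)⁻¹ := by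
        exact inv_anti₀ hq hm3
    _ = 64 * ((1 + t) ^ 6)⁻¹ := by
        field_simp
        ring

/-- **The decay integral**: for `a > 0`,
`∫⁻ ofReal (1/max(a,|x|²)³) ≤ ofReal (64 (√a)³ / a³) · I₆` (`(√a)³/a³ = a^{-3/2}`). -/
theorem lintegral_inv_max_cube_le {a : ℝ} (ha : 0 < a) :
    ∫⁻ x : EuclideanSpace ℝ (Fin 3), ENNReal.ofReal (((max a (‖x‖ ^ 2)) ^ 3)⁻¹) ≤
      ENNReal.ofReal (64 * Real.sqrt a ^ 3 / a ^ 3) *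
        ∫⁻ y : EuclideanSpace ℝ (Fin 3), ENNReal.ofReal ((1 + ‖y‖) ^ (-(6 : ℝ))) := by
  have hsa : 0 < Real.sqrt a := Real.sqrt_pos.2 ha
  set g : EuclideanSpace ℝ (Fin 3) → ℝ≥0∞ := fun x => ENNReal.ofReal (((max a (‖x‖ ^ 2)) ^ 3)⁻¹)
  -- undo the scaling: `g x = f ((√a)⁻¹ • x)` with `f y = g (√a • y)`
  have hscale := lintegral_comp_smul_three (fun y => g (Real.sqrt a • y)) (inv_ne_zero hsa.ne')
  have hid : (fun x : EuclideanSpace ℝ (Fin 3) => g (Real.sqrt a • ((Real.sqrt a)⁻¹ • x))) = g := by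
    funext x; rw [smul_smul, mul_inv_cancel₀ hsa.ne', one_smul]
  rw [hid] at hscale
  rw [hscale, inv_pow, inv_inv, abs_of_pos (pow_pos hsa 3)]
  -- pointwise bound after scaling
  have hpt : ∀ y : EuclideanSpace ℝ (Fin 3), g (Real.sqrt a • y) ≤
      ENNReal.ofReal (64 / a ^ 3) * ENNReal.ofReal ((1 + ‖y‖) ^ (-(6 : ℝ))) := by
    intro y
    have hn : ‖Real.sqrt a • y‖ ^ 2 = a * ‖y‖ ^ 2 := by
      rw [norm_smul, Real.norm_eq_abs, abs_of_pos hsa, mul_pow, Real.sq_sqrt ha.le]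
    have hmax : max a (a * ‖y‖ ^ 2) = a * max 1 (‖y‖ ^ 2) := by
      rw [mul_max_of_nonneg _ _ ha.le, mul_one]
    show ENNReal.ofReal (((max a (‖Real.sqrt a • y‖ ^ 2)) ^ 3)⁻¹) ≤ _
    rw [hn, hmax, mul_pow, mul_inv, ← ENNReal.ofReal_mul (by positivity)]
    refine ENNReal.ofReal_le_ofReal ?_
    rw [div_eq_mul_inv, mul_assoc, mul_comm (64 : ℝ), mul_assoc]
    refine mul_le_mul_of_nonneg_left ?_ (by positivity)
    rw [mul_comm]
    exact inv_max_one_sq_cube_le (norm_nonneg y)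
  calc ENNReal.ofReal (Real.sqrt a ^ 3) * ∫⁻ y, g (Real.sqrt a • y)
      ≤ ENNReal.ofReal (Real.sqrt a ^ 3) *
          ∫⁻ y : EuclideanSpace ℝ (Fin 3), ENNReal.ofReal (64 / a ^ 3) * ENNReal.ofReal ((1 + ‖y‖) ^ (-(6 : ℝ))) := by
        exact mul_le_mul' le_rfl (lintegral_mono hpt)
    _ = ENNReal.ofReal (64 * Real.sqrt a ^ 3 / a ^ 3) *
          ∫⁻ y : EuclideanSpace ℝ (Fin 3), ENNReal.ofReal ((1 + ‖y‖) ^ (-(6 : ℝ))) := by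
        rw [lintegral_const_mul' _ _ ENNReal.ofReal_ne_top, ← mul_assoc,
          ← ENNReal.ofReal_mul (by positivity)]
        congr 2
        field_simp

end Summit.NavierStokesRegularity.NavierStokesRegularity.Theorems.L3TimeExponentPincerRingDatumDecayIntegral
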